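/-
Adjudication Team R (D-0069 campaign, cell siegel-zhang): kernel certificate that the PRINTED
case split in the §4 deduction of Proposition 2.2 (i)–(ii) — skeleton node `Ded22` — misses the
seam `σ = 1/2 + α²`. read2 item R2-4 (PRIOR); the repair (close one range) is routine, so this is
an INSUFFICIENCY-AS-PRINTED certificate: no statement of the manuscript is refuted here, and
nothing here is a claim about Siegel zeros or about Theorems 1–2.
-/
import Literature.NumberTheory.LFunctions.Zhang2022.SkeletonPartOne

/-! # Team R: the `Ded22` boundary seam (read2 R2-4)

The manuscript deduces Proposition 2.2 (i)–(ii) from Lemmas 4.5 and 4.6: "Lemma 4.5 and 4.6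
together imply the assertions (i) and (ii) of Proposition 2.2" [cite: Zhang2022LandauSiegel,
§4 p. 10, tex L1263 (PDF p. 23)]. Lemma 4.5 assumes `1/2 + α² < σ < 1` (strict lower bound)
[tex L1153]; Lemma 4.6 assumes `1/2 ≤ β < 1/2 + α²` (strict upper bound) [tex L1197]. A zero on
the seam `σ = 1/2 + α²` satisfies the hypotheses of NEITHER lemma, and the seam meets `Ω₃` (the
region carrying `prodZeroSetOmega`, Lemma 4.4) inside the common `t`-window `|t − 2πt₀| < 𝓛₁ + 2`
of both lemmas: as printed, the case split leaves a vertical line of candidate zeros uncovered.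
The skeleton types the deduction as the CLAIM node `Skeleton.Ded22 c'`
(`Lemma42 → Lemma45 → Lemma46 c' → Lemma47 c' → Prop22 c'`, SkeletonPartOne); `¬ Ded22` is NOT
provable (the node is an implication claim) and is not asserted — the theorems below certify
exactly the coverage hole of the printed ranges, over the real objects `Skeleton.alpha`,
`Skeleton.Omega3`, `Skeleton.ell1`, `Skeleton.t0`.
-/

namespace Literature.NumberTheory.LFunctions.Zhang2022.AdjTeamR

open Literature.NumberTheory.LFunctions.Zhang2022.Skeleton
open Real

/-- A point on the seam `σ = 1/2 + α²` satisfies neither the σ-range `1/2 + α² < σ < 1` of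
Lemma 4.5 (`Skeleton.Lemma45`, tex L1153) nor the β-range `1/2 ≤ β < 1/2 + α²` of Lemma 4.6
(`Skeleton.Lemma46`, tex L1197) — both strict at the seam as printed.
[cite: Zhang2022LandauSiegel, §4 pp. 9–10, Lemmas 4.5–4.6; read2 R2-4] -/
theorem seam_not_in_printed_ranges (D : ℕ) (s : ℂ)
    (hs : s.re = 1 / 2 + alpha D ^ 2) :
    ¬ (1 / 2 + alpha D ^ 2 < s.re ∧ s.re < 1) ∧
      ¬ (1 / 2 ≤ s.re ∧ s.re < 1 / 2 + alpha D ^ 2) := by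
  constructor
  · rintro ⟨h, -⟩
    rw [hs] at h
    exact lt_irrefl _ h
  · rintro ⟨-, h⟩
    rw [hs] at h
    exact lt_irrefl _ h

/-- THE COVERAGE HOLE of the printed case split of the §4 deduction of Proposition 2.2 (i)–(ii)
(skeleton node `Skeleton.Ded22`), over the real objects: whenever `0 < α < 1` (true for all
large `D`, `α = π/ℓ⁹`; see `alpha_pos`, `alpha_lt_one` below), there is a point `s ∈ Ω₃` with
`1/2 ≤ Re s`, inside the common `t`-window `|Im s − 2πt₀| < 𝓛₁ + 2` of Lemmas 4.5–4.6, for which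
the hypotheses of NEITHER printed range hold. Insufficiency as printed; repairable (close either
range); refutes no lemma. [cite: Zhang2022LandauSiegel, §4 p. 10, tex L1263; read2 R2-4] -/
theorem ded22_printed_split_incomplete (D : ℕ) (h0 : 0 < alpha D) (h1 : alpha D < 1) :
    ∃ s : ℂ, s ∈ Omega3 D ∧ 1 / 2 ≤ s.re ∧ |s.im - 2 * Real.pi * t0 D| < ell1 D + 2 ∧
      ¬ (1 / 2 + alpha D ^ 2 < s.re ∧ s.re < 1) ∧
      ¬ (1 / 2 ≤ s.re ∧ s.re < 1 / 2 + alpha D ^ 2) := by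
  have hsq : 0 ≤ alpha D ^ 2 := sq_nonneg _
  have hℓ1 : (0 : ℝ) ≤ ell1 D := by
    rw [ell1]
    refine pow_nonneg ?_ 405
    rw [ell]
    rcases Nat.eq_zero_or_pos D with h | h
    · simp [h]
    · have h1 : 1 ≤ D := h
      exact Real.log_nonneg (by exact_mod_cast h1)
  have hαα : alpha D ^ 2 < alpha D := by nlinarith
  refine ⟨⟨1 / 2 + alpha D ^ 2, 2 * Real.pi * t0 D⟩, ⟨?_, ?_, ?_⟩, ?_, ?_,
    (seam_not_in_printed_ranges D _ rfl).1, (seam_not_in_printed_ranges D _ rfl).2⟩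
  · show 1 / 2 - alpha D < 1 / 2 + alpha D ^ 2
    linarith
  · show 1 / 2 + alpha D ^ 2 < 1 + alpha D
    linarith
  · show |2 * Real.pi * t0 D - 2 * Real.pi * t0 D| < ell1 D + 3
    simp only [sub_self, abs_zero]
    linarith
  · show (1 : ℝ) / 2 ≤ 1 / 2 + alpha D ^ 2
    linarith
  · show |2 * Real.pi * t0 D - 2 * Real.pi * t0 D| < ell1 D + 2
    simp only [sub_self, abs_zero]
    linarith

/-- `0 < α(D)` for `D ≥ 2` (`α = π/ℓ⁹` by `(2.13)`-side definitions `alpha`, `bigP`).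
[cite: Zhang2022LandauSiegel, §2 (2.13)] -/
theorem alpha_pos {D : ℕ} (hD : 2 ≤ D) : 0 < alpha D := by
  have h2 : (0.6931471803 : ℝ) < Real.log 2 := Real.log_two_gt_d9
  have hm : Real.log 2 ≤ Real.log D := by
    apply Real.log_le_log (by norm_num)
    exact_mod_cast hD
  have hl : (0 : ℝ) < Real.log D := by linarith
  have hα : alpha D = Real.pi / Real.log D ^ 9 := by rw [alpha, bigP, Real.log_exp, ell]
  rw [hα]
  exact div_pos Real.pi_pos (pow_pos hl 9)

/-- `α(D) < 1` for `D ≥ 4`: `ℓ ≥ log 4 > 1.386` and `1.386⁹ > 4 ≥ π`, so `π < ℓ⁹`.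
[cite: Zhang2022LandauSiegel, §2 (2.13)] -/
theorem alpha_lt_one {D : ℕ} (hD : 4 ≤ D) : alpha D < 1 := by
  have h2 : (0.6931471803 : ℝ) < Real.log 2 := Real.log_two_gt_d9
  have hm : Real.log 4 ≤ Real.log D := by
    apply Real.log_le_log (by norm_num)
    exact_mod_cast hD
  have h42 : Real.log 4 = 2 * Real.log 2 := by
    rw [show (4 : ℝ) = 2 ^ 2 by norm_num, Real.log_pow]
    push_cast
    ring
  have h4 : (1.386 : ℝ) < Real.log D := by nlinarith
  have hl : (0 : ℝ) < Real.log D := by linarith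
  have hpow : (1.386 : ℝ) ^ 9 ≤ Real.log D ^ 9 := by
    gcongr
  have hπ : Real.pi < Real.log D ^ 9 := by
    have h4lt : (4 : ℝ) < (1.386 : ℝ) ^ 9 := by norm_num
    have hπ' := Real.pi_le_four
    linarith
  have hα : alpha D = Real.pi / Real.log D ^ 9 := by rw [alpha, bigP, Real.log_exp, ell]
  rw [hα, div_lt_one (pow_pos hl 9)]
  exact hπ

/-- Unconditional form of the coverage hole for every `D ≥ 4`.
[cite: Zhang2022LandauSiegel, §4 p. 10, tex L1263; read2 R2-4] -/
theorem ded22_printed_split_incomplete_of_four_le {D : ℕ} (hD : 4 ≤ D) :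
    ∃ s : ℂ, s ∈ Omega3 D ∧ 1 / 2 ≤ s.re ∧ |s.im - 2 * Real.pi * t0 D| < ell1 D + 2 ∧
      ¬ (1 / 2 + alpha D ^ 2 < s.re ∧ s.re < 1) ∧
      ¬ (1 / 2 ≤ s.re ∧ s.re < 1 / 2 + alpha D ^ 2) :=
  ded22_printed_split_incomplete D (alpha_pos (le_trans (by norm_num) hD)) (alpha_lt_one hD)

end Literature.NumberTheory.LFunctions.Zhang2022.AdjTeamR
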